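import Mathlib
import Literature.MathematicalPhysics.QuantumLattice.WilsonDiracAP
import Summits.QuantumFields.QCD.Theorems.WilsonQuarkChessboardFlatCellOptimalStubHessianMarginAllN
import Summits.QuantumFields.QCD.Theorems.WilsonQuarkChessboardFlatCellOptimalStubTilingCombinatoricsAllN
import Summits.QuantumFields.QCD.Theorems.WilsonQuarkChessboardFlatCellOptimalStubUnitaryCellIneqAllN
import Summits.QuantumFields.QCD.Theorems.WilsonQuarkChessboardFlatCellOptimalStubOneLoopMarginOfAuxAllN

/-!
# P6 — the one-loop cell margin for every colour number `N` and every half-side `M ≥ 2`, no slack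
(helper for crux stmt-QuantumFields-9307 `FlatCellOptimal`, line `registered`, stub
`stub_localNormGain_of` (G4 transport), sub-goal `stub_oneLoopMarginAllN` — the `Fin 3 ↦ Fin N`,
SLACK-FREE, threshold-free port of the sibling crux stmt-QuantumFields-9734's P6
`…CriticalLineDiamagnetismStubOneLoopMargin`, wave 13)

What.  On the even torus `(ℤ/2M)⁴`, `M ≥ 2`, let `tile_c V` be the period-2 reflection tiling of the
`U(N)` gauge field `V` about the corner `c`, `W_c : Edge 4 2 → U(N)` the tiling read on the `2⁴` block,
`B⁰_k = D₂[ζ_k ω](m)` the free `r = 1` Wilson–Dirac Bloch blocks (`ω = e^{iπ/(2M)}·1`,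
`ζ_k(μ) = e^{iπ k_μ/M}·1`) and `B_k = D₂[ζ_k ω W_c](m)` the perturbed blocks (all four universally
quantified with their defining equations — no `let` in the registered signature).  With
`R_k = B⁰_k⁻¹ (B_k − B⁰_k)`, the quadratic part of `Σ_k log |det B_k / det B⁰_k|` satisfies, for every
`N : ℕ`, every `M ≥ 2`, `|m| ≤ ε`, `η ≤ η₀` and `η`-small cell links of `V`,
`Σ_k (Re tr R_k − ½ Re tr R_k²) ≤ −c_q M⁴ Σ_{cell plaquettes} (N − Re tr V_p)
  + C_q √η M⁴ Σ_{cell links} (N − Re tr V_e)`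
with `N`-free constants `c_q = 4c′`, `C_q = 2(288 c′ + 104 (max C_Σ 0 + 1))`, `ε = min ε_H ε_Σ`,
`η₀ = 1` (`c′, ε_H` from the all-`N` Hessian margin `stub_hessianMarginAllN`, `C_Σ, ε_Σ` from the
antiperiodic lattice sum `stub_blochLatticeSum`).  Compared with the sibling's P6 (`N = 3`): no additive
constant `K_q` and no threshold `M₀` — the margin holds for every `M ≥ 2`.

How.  The sibling assembly `stub_oneLoopMargin_of` ported verbatim to the `N`-colour inputs landed for
this crux (namespaces `…FlatCellOptimal.*`): (0) `B_k − B⁰_k = Δ_k(E)`, `E = W_c − 1`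
(`TangentDelta.wilsonDirac_dir_sub_eq`), so `Re tr R_k = ℓ_k(E)`, `Re tr R_k² = 𝔅_k(E,E)`;
(1) `Im S_μ(E) = 0`, `Re S_μ(E) = −D_μ` and `Y = (E − Eᴴ)/2` anti-Hermitian, tiling-odd
(`stub_oneLoopMarginOfAuxAllN`, from `W_c(x + μ̂, μ) = W_c(x, μ)⁻¹`, `stub_tilingCombinatoricsAllN` (i)),
hence by the tadpole `stub_tadpoleAllN` `Σ_k ℓ_k(E) = −Σ_μ T_μ D_μ`; (2) `E = Y + H`, the bilinear bounds
`stub_bilinearBoundsAllN` (a)–(c) and the DIMENSION-FREE tadpole bound (d2) `|ℓ_k(tst_μ)| ≤ 80/√c₀(k)`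
give `|𝔅_k(E,E) − 𝔅_k(Y,Y)| ≤ 128 √η D/c₀(k)`, `|T_μ| ≤ 80 Λ`; (3) the Hessian margin
`stub_hessianMarginAllN` (every `N`, every `M ≥ 2`): `𝓗_M(Y) ≥ c′ M⁴ 𝒦(Y)`; (4) the unitary cell
inequalities `stub_unitaryCellIneqAllN` + `stub_tilingCombinatoricsAllN` (ii):
`4S = Σ_p d_p(W_c) ≤ 𝒦(Y) + 288 η D`; (5) coercivity of the free blocks `stub_freeBlochBlocksAllN` with
`c₀(k) = min_s h_k(s) > 0` (`CellGainCore.symbol_pos`), `c₀⁻¹, c₀^{-1/2} ≤ 1 + c₀^{-3/2}`, and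
`stub_blochLatticeSum` (every `M`); `D ≤ 2F` and the cell links (`stub_tilingCellDataAllN`); (6) the
sibling's `N`-free real bookkeeping `OneLoopMarginOf.bookkeeping` (`K_q = 0`).
Sources: Montvay–Münster, *Quantum Fields on a Lattice* §4.2 (Wilson fermions, hopping expansion); the
Hessian margin rests on interval-arithmetic certificates (computational lane).  Pure theorem file
(no `def`s).
-/

noncomputable section

open scoped BigOperators Classical Matrix ComplexConjugate
open Finset
open Literature.MathematicalPhysics.QuantumLattice Literature.MathematicalPhysics.QuantumFieldTheory
  Literature.Probability.LatticeModels

namespace Summit.QuantumFields.QCD.Cruxes.FlatCellOptimal.OneLoop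

open OneLoopMarginOf
open Summit.QuantumFields.QCD.Cruxes.CriticalLineDiamagnetism.ChessboardCellGain (stub_blochLatticeSum)
open Summit.QuantumFields.QCD.Cruxes.CriticalLineDiamagnetism.ChessboardCellGain.CellGainCore (symbol_pos)
open Summit.QuantumFields.QCD.Cruxes.FlatCellOptimal.HessianMargin (stub_hessianMarginAllN)
open Summit.QuantumFields.QCD.Cruxes.FlatCellOptimal.HessianMargin.HessianMarginAllN (coe_zeta_mul_omega)
open Summit.QuantumFields.QCD.Cruxes.FlatCellOptimal.TilingData
  (stub_tilingCombinatoricsAllN stub_tilingCellDataAllN)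
open Summit.QuantumFields.QCD.Cruxes.FlatCellOptimal.UnitaryCell (stub_unitaryCellIneqAllN)
open Summit.QuantumFields.QCD.Cruxes.FlatCellOptimal.Tadpole (stub_tadpoleAllN)
open Summit.QuantumFields.QCD.Cruxes.FlatCellOptimal.FreeBlocks (stub_freeBlochBlocksAllN)
open Summit.QuantumFields.QCD.Cruxes.FlatCellOptimal.BilinearBounds (stub_bilinearBoundsAllN)
open Summit.QuantumFields.QCD.Cruxes.FlatCellOptimal.CellGain (CellGainOfGauged.deficit_nonneg)

/-- **Sub-goal `stub_oneLoopMarginAllN` (G4, wave 13) — P6, the one-loop cell margin for every `N` and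
every `M ≥ 2`, without additive slack.**  Witnesses `c_q = 4c′`, `C_q = 2(288c′ + 104(max C_Σ 0 + 1))`,
`ε = min ε_H ε_Σ`, `η₀ = 1`.  For `|m| ≤ ε`, `η ≤ 1`, a `U(N)` field `V` on `(ℤ/2M)⁴` whose cell links at
`c` have deficit `≤ η`, the tiling `tile`, its block read `W_c`, the free blocks `B⁰_k` and the perturbed
blocks `B_k` (given by their defining equations):
`Σ_k (Re tr R_k − ½ Re tr R_k²) ≤ −c_q M⁴ S + C_q √η M⁴ F`, `R_k = B⁰_k⁻¹(B_k − B⁰_k)`, `S` the cell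
plaquette deficit and `F` the cell link deficit of `V`.  See the module docstring for the proof. -/
theorem stub_oneLoopMarginAllN : ∃ cq Cq ε η₀ : ℝ, 0 < cq ∧ 0 < ε ∧ 0 < η₀ ∧ ∀ (N M : ℕ) [NeZero M], 2 ≤ M → ∀ (m : ℝ), |m| ≤ ε → ∀ (V : GaugeConfig 4 (2 * M) (Matrix.unitaryGroup (Fin N) ℂ)) (c : Site 4 (2 * M)) (ω : Matrix.unitaryGroup (Fin N) ℂ) (ζ : (Fin 4 → Fin M) → Fin 4 → Matrix.unitaryGroup (Fin N) ℂ), ((ω : Matrix.unitaryGroup (Fin N) ℂ) : Matrix (Fin N) (Fin N) ℂ) = Complex.exp (↑(Real.pi / (2 * M : ℕ)) * Complex.I) • (1 : Matrix (Fin N) (Fin N) ℂ) → (∀ k μ, ((ζ k μ : Matrix.unitaryGroup (Fin N) ℂ) : Matrix (Fin N) (Fin N) ℂ) = Complex.exp (Real.pi * Complex.I * ((k μ : ℕ) : ℂ) / (M : ℂ)) • (1 : Matrix (Fin N) (Fin N) ℂ)) → ∀ η : ℝ, η ≤ η₀ → (∀ e : Edge 4 (2 * M), ((∀ ν, (e.1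 ν - c ν).val ≤ 1) ∧ (e.1 e.2 - c e.2).val = 0) → (N : ℝ) - ((V e : Matrix.unitaryGroup (Fin N) ℂ) : Matrix (Fin N) (Fin N) ℂ).trace.re ≤ η) → ∀ (tile : Site 4 (2 * M) → GaugeConfig 4 (2 * M) (Matrix.unitaryGroup (Fin N) ℂ) → GaugeConfig 4 (2 * M) (Matrix.unitaryGroup (Fin N) ℂ)) (Wc : GaugeConfig 4 2 (Matrix.unitaryGroup (Fin N) ℂ)) (B0 B1 : (Fin 4 → Fin M) → Matrix (TorusSite 4 2 × Fin N × Fin 4) (TorusSite 4 2 × Fin N × Fin 4) ℂ), (∀ (c : Site 4 (2 * M)) (V : GaugeConfig 4 (2 * M) (Matrix.unitaryGroup (Fin N) ℂ)) (e : Edge 4 (2 * M)), tile c V e = if (e.1 e.2 - c e.2).val % 2 = 0 then V (fun ν => c ν + (((e.1 ν - c ν).val % 2 : ℕ) : ZMod (2 * M)), e.2) else (V (fun ν => c ν + (((Site.shift e.1 e.2 ν - c ν).val % 2 : ℕ) : ZMod (2 * M)), e.2))⁻¹) → (∀ e : Edge 4 2, Wc e = tile c V (fun ν => c ν + (((e.1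 ν).val : ℕ) : ZMod (2 * M)), e.2)) → (∀ k, B0 k = wilsonDirac (unitaryFundamentalRep (Fin N) ℂ) (fun e : Edge 4 2 => ζ k e.2 * ω) m 1) → (∀ k, B1 k = wilsonDirac (unitaryFundamentalRep (Fin N) ℂ) (fun e : Edge 4 2 => ζ k e.2 * ω * Wc e) m 1) → ∑ k : Fin 4 → Fin M, (((B0 k)⁻¹ * (B1 k - B0 k)).trace.re - ((B0 k)⁻¹ * (B1 k - B0 k) * ((B0 k)⁻¹ * (B1 k - B0 k))).trace.re / 2) ≤ -(cq * (M : ℝ) ^ 4 * ∑ p ∈ Finset.univ.filter (fun p : Plaquette 4 (2 * M) => p.1 p.2.1.1 = c p.2.1.1 ∧ p.1 p.2.1.2 = c p.2.1.2 ∧ ∀ ν, ν ≠ p.2.1.1 → ν ≠ p.2.1.2 → (p.1 ν = c ν ∨ p.1 ν = c ν + 1)), ((N : ℝ) - (unitaryFundamentalRep (Fin N) ℂ (plaquetteHolonomy V p.1 p.2.1.1 p.2.1.2)).trace.re)) + Cq * Real.sqrt η * (M : ℝ) ^ 4 * ∑ e ∈ Finset.univ.filter (fun e : Edge 4 (2 *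 M) => (∀ ν, (e.1 ν - c ν).val ≤ 1) ∧ (e.1 e.2 - c e.2).val = 0), ((N : ℝ) - ((V e : Matrix.unitaryGroup (Fin N) ℂ) : Matrix (Fin N) (Fin N) ℂ).trace.re) := by
  obtain ⟨c', εH, hc', hεH, hMg⟩ := stub_hessianMarginAllN
  obtain ⟨CS, εS, hεS, hLS⟩ := stub_blochLatticeSum
  refine ⟨4 * c', 2 * (288 * c' + 104 * (max CS 0 + 1)), min εH εS, 1, by positivity,
    lt_min hεH hεS, one_pos, ?_⟩
  intro N M _ hM m hm V c ω ζ hω hζ η hη1 hlinks tile Wc B0 B1 htile hWc hB0 hB1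
  have hmH : |m| ≤ εH := hm.trans (min_le_left _ _)
  have hmS : |m| ≤ εS := hm.trans (min_le_right _ _)
  -- the two cell sums
  set S : ℝ := ∑ p ∈ univ.filter (fun p : Plaquette 4 (2 * M) => p.1 p.2.1.1 = c p.2.1.1 ∧
      p.1 p.2.1.2 = c p.2.1.2 ∧ ∀ ν, ν ≠ p.2.1.1 → ν ≠ p.2.1.2 → (p.1 ν = c ν ∨ p.1 ν = c ν + 1)),
    ((N : ℝ) - (unitaryFundamentalRep (Fin N) ℂ (plaquetteHolonomy V p.1 p.2.1.1 p.2.1.2)).trace.re)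
  set F : ℝ := ∑ e ∈ univ.filter (fun e : Edge 4 (2 * M) => (∀ ν, (e.1 ν - c ν).val ≤ 1) ∧
      (e.1 e.2 - c e.2).val = 0),
    ((N : ℝ) - ((V e : Matrix.unitaryGroup (Fin N) ℂ) : Matrix (Fin N) (Fin N) ℂ).trace.re)
  -- (C) the tiling combinatorics
  obtain ⟨hWinv, hWS⟩ : (∀ (x : TorusSite 4 2) (μ : Fin 4), Wc (Site.shift x μ, μ) = (Wc (x, μ))⁻¹) ∧
      ∑ p : Plaquette 4 2, ((N : ℝ) - (unitaryFundamentalRep (Fin N) ℂ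
        (plaquetteHolonomy Wc p.1 p.2.1.1 p.2.1.2)).trace.re) = 4 * S :=
    stub_tilingCombinatoricsAllN N M tile htile V c Wc hWc
  -- the tiling cell data: cell links and `D ≤ 2F`
  set D : ℝ := ∑ e : Edge 4 2,
    ((N : ℝ) - ((Wc e : Matrix.unitaryGroup (Fin N) ℂ) : Matrix (Fin N) (Fin N) ℂ).trace.re) with hD_def
  obtain ⟨hWlink, hDF⟩ : (∀ e : Edge 4 2, ∃ e' : Edge 4 (2 * M),
      ((∀ ν, (e'.1 ν - c ν).val ≤ 1) ∧ (e'.1 e'.2 - c e'.2).val = 0) ∧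
        ((Wc e : Matrix.unitaryGroup (Fin N) ℂ) : Matrix (Fin N) (Fin N) ℂ).trace.re =
          ((V e' : Matrix.unitaryGroup (Fin N) ℂ) : Matrix (Fin N) (Fin N) ℂ).trace.re) ∧
      D ≤ 2 * F :=
    stub_tilingCellDataAllN N M tile htile V c Wc hWc
  have hWη : ∀ e : Edge 4 2,
      (N : ℝ) - ((Wc e : Matrix.unitaryGroup (Fin N) ℂ) : Matrix (Fin N) (Fin N) ℂ).trace.re ≤ η := by
    intro e
    obtain ⟨e', he', htr⟩ := hWlink e
    rw [htr]
    exact hlinks e' he'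
  have hη0 : 0 ≤ η := (CellGainOfGauged.deficit_nonneg _).trans (hWη ((0 : TorusSite 4 2), 0))
  have hD0 : 0 ≤ D := Finset.sum_nonneg fun e _ => CellGainOfGauged.deficit_nonneg _
  -- `E = W_c − 1 = Y + H`
  set E : Edge 4 2 → Matrix (Fin N) (Fin N) ℂ := fun e =>
    ((Wc e : Matrix.unitaryGroup (Fin N) ℂ) : Matrix (Fin N) (Fin N) ℂ) - 1 with hE_def
  set Y : Edge 4 2 → Matrix (Fin N) (Fin N) ℂ := fun e => (1 / 2 : ℂ) • (E e - (E e)ᴴ) with hY_def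
  set H : Edge 4 2 → Matrix (Fin N) (Fin N) ℂ := E - Y with hH_def
  -- (U) the unitary cell inequalities
  set K : ℝ := ∑ p : Plaquette 4 2, ∑ a, ∑ b, ‖(Y (p.1, p.2.1.1) + Y (Site.shift p.1 p.2.1.1, p.2.1.2) -
    Y (Site.shift p.1 p.2.1.2, p.2.1.1) - Y (p.1, p.2.1.2)) a b‖ ^ 2
  obtain ⟨hE2, hPyth, hHle, hplaq⟩ :
      (∀ e : Edge 4 2, ∑ a, ∑ b, ‖E e a b‖ ^ 2 =
        2 * ((N : ℝ) - ((Wc e : Matrix.unitaryGroup (Fin N) ℂ) : Matrix (Fin N) (Fin N) ℂ).trace.re)) ∧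
      (∀ e : Edge 4 2, ∑ a, ∑ b, ‖E e a b‖ ^ 2 = (∑ a, ∑ b, ‖Y e a b‖ ^ 2) + ∑ a, ∑ b, ‖H e a b‖ ^ 2) ∧
      (∀ e : Edge 4 2, ∑ a, ∑ b, ‖H e a b‖ ^ 2 ≤
        η * ((N : ℝ) - ((Wc e : Matrix.unitaryGroup (Fin N) ℂ) : Matrix (Fin N) (Fin N) ℂ).trace.re)) ∧
      ∑ p : Plaquette 4 2, ((N : ℝ) - (unitaryFundamentalRep (Fin N) ℂ
        (plaquetteHolonomy Wc p.1 p.2.1.1 p.2.1.2)).trace.re) ≤ K + 288 * η * D :=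
    stub_unitaryCellIneqAllN N Wc η hWη E Y (fun _ => rfl) (fun _ => rfl)
  have hK : 4 * S ≤ K + 288 * η * D := hWS.symm.le.trans hplaq
  -- `Y` is anti-Hermitian and tiling-odd, the colour traces of `E` (C(i))
  set Dμ : Fin 4 → ℝ := fun μ => ∑ x : TorusSite 4 2,
    ((N : ℝ) - ((Wc (x, μ) : Matrix.unitaryGroup (Fin N) ℂ) : Matrix (Fin N) (Fin N) ℂ).trace.re)
    with hDμ_def
  obtain ⟨hYanti, hYodd, him, hre⟩ : (∀ e, (Y e)ᴴ = -Y e) ∧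
      (∀ (x : TorusSite 4 2) (μ : Fin 4), Y (Site.shift x μ, μ) = -Y (x, μ)) ∧
      (∀ μ : Fin 4, (∑ x : TorusSite 4 2, (E (x, μ)).trace).im = 0) ∧
      (∀ μ : Fin 4, (∑ x : TorusSite 4 2, (E (x, μ)).trace).re = -Dμ μ) :=
    stub_oneLoopMarginOfAuxAllN N Wc E Y (fun _ => rfl) (fun _ => rfl) hWinv
  -- the norms of `Y`, `H` (U)
  set nY : ℝ := ∑ e : Edge 4 2, ∑ a, ∑ b, ‖Y e a b‖ ^ 2 with hnY_def
  set nH : ℝ := ∑ e : Edge 4 2, ∑ a, ∑ b, ‖H e a b‖ ^ 2 with hnH_def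
  set nYd : Fin 4 → ℝ := fun μ => ∑ x : TorusSite 4 2, ∑ a, ∑ b, ‖Y (x, μ) a b‖ ^ 2 with hnYd_def
  set nHd : Fin 4 → ℝ := fun μ => ∑ x : TorusSite 4 2, ∑ a, ∑ b, ‖H (x, μ) a b‖ ^ 2 with hnHd_def
  have hDab : ∀ μ, 2 * Dμ μ = nYd μ + nHd μ := by
    intro μ
    rw [hDμ_def, hnYd_def, hnHd_def, Finset.mul_sum, ← Finset.sum_add_distrib]
    exact Finset.sum_congr rfl fun x _ => by rw [← hE2, hPyth]
  have hb : ∑ μ, nHd μ = nH := (sum_edge_eq_sum_dir fun e => ∑ a, ∑ b, ‖H e a b‖ ^ 2).symm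
  have hnH0 : 0 ≤ nH := by rw [hnH_def]; positivity
  have hb0 : ∀ μ, 0 ≤ nHd μ := fun μ => by rw [hnHd_def]; positivity
  have hD2 : ∑ e : Edge 4 2, ∑ a, ∑ b, ‖E e a b‖ ^ 2 = 2 * D := by
    rw [hD_def, Finset.mul_sum]
    exact Finset.sum_congr rfl fun e _ => hE2 e
  have hnY : nY ≤ 2 * D := by
    rw [← hD2, hnY_def]
    exact Finset.sum_le_sum fun e _ => by rw [hPyth e]; exact le_add_of_nonneg_right (by positivity)
  have hnH : nH ≤ η * D := by
    rw [hD_def, hnH_def, Finset.mul_sum]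
    exact Finset.sum_le_sum fun e _ => hHle e
  -- the Bloch phases, the free symbol and the coercivity of the free blocks
  set θ : (Fin 4 → Fin M) → Fin 4 → ℝ := fun k μ =>
    Real.pi * ((k μ : ℕ) : ℝ) / M + Real.pi / (2 * M) with hθ_def
  have hu : ∀ (k : Fin 4 → Fin M) (μ : Fin 4),
      (((fun ν => ζ k ν * ω) μ : Matrix.unitaryGroup (Fin N) ℂ) : Matrix (Fin N) (Fin N) ℂ) =
        Complex.exp (↑(θ k μ) * Complex.I) • (1 : Matrix (Fin N) (Fin N) ℂ) :=
    fun k μ => coe_zeta_mul_omega hω (hζ k μ)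
  set hh : (Fin 4 → Fin M) → (Fin 4 → ZMod 2) → ℝ := fun k s =>
    (m + ∑ μ : Fin 4, (1 - Real.cos (Real.pi * ((s μ).val : ℝ) + θ k μ))) ^ 2 +
      ∑ μ : Fin 4, Real.sin (Real.pi * ((s μ).val : ℝ) + θ k μ) ^ 2 with hhh_def
  have hpos : ∀ k s, 0 < hh k s := fun k s => symbol_pos m k s
  have hmin : ∀ k, ∃ s₁, ∀ s, hh k s₁ ≤ hh k s := fun k => by
    obtain ⟨s₁, -, h⟩ := Finset.exists_min_image Finset.univ (hh k) Finset.univ_nonempty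
    exact ⟨s₁, fun s => h s (Finset.mem_univ s)⟩
  choose s₀ hs₀ using hmin
  set c₀ : (Fin 4 → Fin M) → ℝ := fun k => hh k (s₀ k) with hc₀_def
  have hc₀ : ∀ k, 0 < c₀ k := fun k => hpos k _
  have hcoer : ∀ (k : Fin 4 → Fin M) (v : TorusSite 4 2 × Fin N × Fin 4 → ℂ),
      c₀ k * ∑ i, ‖v i‖ ^ 2 ≤ ∑ i, ‖((B0 k).mulVec v) i‖ ^ 2 := fun k =>
    (stub_freeBlochBlocksAllN N (θ k) m (fun ν => ζ k ν * ω) (hu k) (B0 k) (hh k) (hB0 k)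
      (fun _ => rfl)).2 (c₀ k) (hs₀ k)
  -- the hopping form `Δ_k`, `ℓ_k`, `𝔅_k`, the test fields
  obtain ⟨Dl, hDl⟩ : ∃ Dl : (Fin 4 → Fin M) → (Edge 4 2 → Matrix (Fin N) (Fin N) ℂ) →
      Matrix (TorusSite 4 2 × Fin N × Fin 4) (TorusSite 4 2 × Fin N × Fin 4) ℂ, ∀ k E', Dl k E' =
      Matrix.of fun (p q : TorusSite 4 2 × Fin N × Fin 4) => -(1 / 2 : ℂ) * ∑ μ : Fin 4,
        ((if q.1 = Site.shift p.1 μ then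
          ((1 : Matrix (Fin 4) (Fin 4) ℂ) - euclideanGamma μ) p.2.2 q.2.2 *
            (((ζ k μ * ω : Matrix.unitaryGroup (Fin N) ℂ) : Matrix (Fin N) (Fin N) ℂ) * E' (p.1, μ))
              p.2.1 q.2.1 else 0) + (if p.1 = Site.shift q.1 μ then
          ((1 : Matrix (Fin 4) (Fin 4) ℂ) + euclideanGamma μ) p.2.2 q.2.2 *
            (((ζ k μ * ω : Matrix.unitaryGroup (Fin N) ℂ) : Matrix (Fin N) (Fin N) ℂ) * E' (q.1, μ))ᴴ
              p.2.1 q.2.1 else 0)) :=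
    ⟨_, fun _ _ => rfl⟩
  set ell : (Fin 4 → Fin M) → (Edge 4 2 → Matrix (Fin N) (Fin N) ℂ) → ℝ := fun k E' =>
    ((B0 k)⁻¹ * Dl k E').trace.re with hell_def
  set bf : (Fin 4 → Fin M) → (Edge 4 2 → Matrix (Fin N) (Fin N) ℂ) →
      (Edge 4 2 → Matrix (Fin N) (Fin N) ℂ) → ℝ := fun k E₁ E₂ =>
    ((B0 k)⁻¹ * Dl k E₁ * ((B0 k)⁻¹ * Dl k E₂)).trace.re with hbf_def
  set tst : Fin 4 → (Edge 4 2 → Matrix (Fin N) (Fin N) ℂ) := fun μ e =>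
    if e = ((0 : TorusSite 4 2), μ) then (1 / (N : ℂ)) • (1 : Matrix (Fin N) (Fin N) ℂ) else 0
    with htst_def
  -- (Bd) the bilinear bounds, block by block (4th conjunct = the dimension-free tadpole bound (d2))
  have hBdk : ∀ k : Fin 4 → Fin M,
      (∀ E₁ E₂ : Edge 4 2 → Matrix (Fin N) (Fin N) ℂ, Dl k (E₁ + E₂) = Dl k E₁ + Dl k E₂) ∧
      (∀ (r : ℝ) (E' : Edge 4 2 → Matrix (Fin N) (Fin N) ℂ), Dl k (r • E') = (r : ℂ) • Dl k E') ∧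
      (∀ E₁ E₂ : Edge 4 2 → Matrix (Fin N) (Fin N) ℂ, |bf k E₁ E₂| ≤
        32 / c₀ k * Real.sqrt (∑ e, ∑ a, ∑ b, ‖E₁ e a b‖ ^ 2) *
          Real.sqrt (∑ e, ∑ a, ∑ b, ‖E₂ e a b‖ ^ 2)) ∧
      (∀ μ : Fin 4, |ell k (tst μ)| ≤ 80 / Real.sqrt (c₀ k)) :=
    fun k => stub_bilinearBoundsAllN N m (fun ν => ζ k ν * ω) (c₀ k) (hc₀ k) (B0 k) (Dl k) (hB0 k)
      (hDl k) (hcoer k)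
  -- (T) the tadpole, block by block
  have hTk : ∀ (k : Fin 4 → Fin M) (E' : Edge 4 2 → Matrix (Fin N) (Fin N) ℂ),
      (∀ μ : Fin 4, (∑ x : TorusSite 4 2, (E' (x, μ)).trace).im = 0) →
        ell k E' = ∑ μ : Fin 4, ell k (tst μ) * (∑ x : TorusSite 4 2, (E' (x, μ)).trace).re :=
    fun k => stub_tadpoleAllN N m (θ k) (fun ν => ζ k ν * ω) (hu k) (B0 k) (Dl k) (hB0 k) (hDl k)
  -- (Mg) the Hessian margin at `Y`
  have hMgY : c' * (M : ℝ) ^ 4 * K ≤ (∑ k : Fin 4 → Fin M, bf k Y Y) / 2 +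
      (∑ μ : Fin 4, (∑ k : Fin 4 → Fin M, ell k (tst μ)) * nYd μ) / 2 :=
    hMg N M hM m hmH ω ζ hω hζ B0 Dl hB0 hDl Y hYanti hYodd
  -- (0) `B_k − B⁰_k = Δ_k(E)`
  have hΔ : ∀ k : Fin 4 → Fin M, B1 k - B0 k = Dl k E := by
    intro k
    rw [hB1 k, hB0 k, hDl k E]
    exact wilsonDirac_dir_sub_eq (fun ν => ζ k ν * ω) Wc m E fun _ => rfl
  have hq : ∀ k : Fin 4 → Fin M, ((B0 k)⁻¹ * (B1 k - B0 k)).trace.re -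
      ((B0 k)⁻¹ * (B1 k - B0 k) * ((B0 k)⁻¹ * (B1 k - B0 k))).trace.re / 2 =
        ell k E - bf k E E / 2 := by
    intro k
    rw [hΔ k]
  -- (2) `𝔅_k(E,E) = 𝔅_k(Y,Y) + [𝔅_k(Y,H) + 𝔅_k(H,Y) + 𝔅_k(H,H)]`
  have hEYH : E = Y + H := (add_sub_cancel Y E).symm
  have hbfE : ∀ k : Fin 4 → Fin M, bf k E E = bf k Y Y + (bf k Y H + bf k H Y + bf k H H) := by
    intro k
    have hDlE : Dl k E = Dl k Y + Dl k H := by rw [hEYH]; exact (hBdk k).1 Y H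
    have h := re_trace_add_mul_add ((B0 k)⁻¹ * Dl k Y) ((B0 k)⁻¹ * Dl k H)
    rw [← Matrix.mul_add, ← hDlE] at h
    exact h
  have hQ : ∑ k : Fin 4 → Fin M, (((B0 k)⁻¹ * (B1 k - B0 k)).trace.re -
      ((B0 k)⁻¹ * (B1 k - B0 k) * ((B0 k)⁻¹ * (B1 k - B0 k))).trace.re / 2) =
      ∑ k : Fin 4 → Fin M, ell k E - (∑ k : Fin 4 → Fin M, bf k Y Y +
        ∑ k : Fin 4 → Fin M, (bf k Y H + bf k H Y + bf k H H)) / 2 := by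
    rw [Finset.sum_congr rfl fun k _ => hq k, Finset.sum_sub_distrib, ← Finset.sum_add_distrib,
      Finset.sum_div]
    congr 1
    exact Finset.sum_congr rfl fun k _ => by rw [hbfE k]
  -- (1) the tadpole: `Σ_k ℓ_k(E) = −Σ_μ T_μ D_μ`
  have hL : ∑ k : Fin 4 → Fin M, ell k E =
      -∑ μ : Fin 4, (∑ k : Fin 4 → Fin M, ell k (tst μ)) * Dμ μ := by
    have h1 : ∀ k, ell k E = ∑ μ, ell k (tst μ) * (-Dμ μ) := fun k => by
      rw [hTk k E him]
      exact Finset.sum_congr rfl fun μ _ => by rw [hre μ]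
    rw [Finset.sum_congr rfl fun k _ => h1 k, Finset.sum_comm, ← Finset.sum_neg_distrib]
    exact Finset.sum_congr rfl fun μ _ => by
      simp only [mul_neg, Finset.sum_neg_distrib, Finset.sum_mul]
  -- (6) the lattice sums: `c₀⁻¹, c₀^{-1/2} ≤ c₀^{-3/2} + 1`, `Σ_k c₀(k)^{-3/2} ≤ C_Σ M⁴`
  set t : (Fin 4 → Fin M) → ℝ := fun k => Real.sqrt (c₀ k) / c₀ k ^ 2 with ht_def
  have ht1 : ∀ k, 1 / c₀ k ≤ t k + 1 := fun k => inv_le (c₀ k) (hc₀ k)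
  have ht2 : ∀ k, 1 / Real.sqrt (c₀ k) ≤ t k + 1 := fun k => inv_sqrt_le (c₀ k) (hc₀ k)
  have ht0 : ∀ k, 0 ≤ t k + 1 := fun k =>
    add_nonneg (div_nonneg (Real.sqrt_nonneg _) (sq_nonneg _)) zero_le_one
  set Λ : ℝ := ∑ k : Fin 4 → Fin M, (t k + 1) with hΛ_def
  have hΛ0 : 0 ≤ Λ := Finset.sum_nonneg fun k _ => ht0 k
  have hM4 : (1 : ℝ) ≤ (M : ℝ) ^ 4 := one_le_pow₀ (by exact_mod_cast NeZero.one_le)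
  have hΛ : Λ ≤ (max CS 0 + 1) * (M : ℝ) ^ 4 := by
    have h1 : ∑ k, t k ≤ CS * (M : ℝ) ^ 4 :=
      calc ∑ k, t k ≤ ∑ k : Fin 4 → Fin M, ∑ s : Fin 4 → ZMod 2, Real.sqrt (hh k s) / hh k s ^ 2 :=
            Finset.sum_le_sum fun k _ => Finset.single_le_sum
              (f := fun s => Real.sqrt (hh k s) / hh k s ^ 2)
              (fun s _ => div_nonneg (Real.sqrt_nonneg _) (sq_nonneg _)) (mem_univ (s₀ k))
        _ ≤ CS * (M : ℝ) ^ 4 := hLS M m hmS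
    have h2 : ∑ _k : Fin 4 → Fin M, (1 : ℝ) = (M : ℝ) ^ 4 := by
      rw [Finset.sum_const, Finset.card_univ, Fintype.card_fun, Fintype.card_fin, Fintype.card_fin,
        nsmul_eq_mul, mul_one, Nat.cast_pow]
    have h3 : CS * (M : ℝ) ^ 4 ≤ max CS 0 * (M : ℝ) ^ 4 :=
      mul_le_mul_of_nonneg_right (le_max_left _ _) (pow_nonneg (Nat.cast_nonneg _) 4)
    rw [hΛ_def, Finset.sum_add_distrib, h2, add_mul, one_mul]
    exact add_le_add (h1.trans h3) le_rfl
  -- the tadpole coefficients `|T_μ| ≤ 80 Λ` (from the dimension-free bound (d2))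
  have hell_tst : ∀ (k : Fin 4 → Fin M) (μ : Fin 4), |ell k (tst μ)| ≤ 80 * (t k + 1) := by
    intro k μ
    calc |ell k (tst μ)| ≤ 80 / Real.sqrt (c₀ k) := (hBdk k).2.2.2 μ
      _ = 80 * (1 / Real.sqrt (c₀ k)) := by ring
      _ ≤ 80 * (t k + 1) := mul_le_mul_of_nonneg_left (ht2 k) (by norm_num)
  have hTb : ∀ μ, |∑ k : Fin 4 → Fin M, ell k (tst μ)| ≤ 80 * Λ := fun μ =>
    (Finset.abs_sum_le_sum_abs _ _).trans (by
      rw [hΛ_def, Finset.mul_sum]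
      exact Finset.sum_le_sum fun k _ => hell_tst k μ)
  -- the mixed errors `|𝔅_k(Y,H) + 𝔅_k(H,Y) + 𝔅_k(H,H)| ≤ 32 (t_k + 1) (2‖Y‖‖H‖ + ‖H‖²)`
  have hmix0 : 0 ≤ 2 * Real.sqrt nY * Real.sqrt nH + nH :=
    add_nonneg (mul_nonneg (mul_nonneg zero_le_two (Real.sqrt_nonneg _)) (Real.sqrt_nonneg _)) hnH0
  have herr : ∀ k : Fin 4 → Fin M, |bf k Y H + bf k H Y + bf k H H| ≤
      32 * (t k + 1) * (2 * Real.sqrt nY * Real.sqrt nH + nH) := by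
    intro k
    obtain ⟨-, -, hb2, -⟩ := hBdk k
    have h1 : |bf k Y H| ≤ 32 / c₀ k * Real.sqrt nY * Real.sqrt nH := hb2 Y H
    have h2 : |bf k H Y| ≤ 32 / c₀ k * Real.sqrt nH * Real.sqrt nY := hb2 H Y
    have h3 : |bf k H H| ≤ 32 / c₀ k * Real.sqrt nH * Real.sqrt nH := hb2 H H
    have h4 : Real.sqrt nH * Real.sqrt nH = nH := Real.mul_self_sqrt hnH0
    have h5 : 32 / c₀ k ≤ 32 * (t k + 1) :=
      calc 32 / c₀ k = 32 * (1 / c₀ k) := by ring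
        _ ≤ 32 * (t k + 1) := mul_le_mul_of_nonneg_left (ht1 k) (by norm_num)
    calc |bf k Y H + bf k H Y + bf k H H| ≤ |bf k Y H| + |bf k H Y| + |bf k H H| :=
          abs_add_three _ _ _
      _ ≤ 32 / c₀ k * Real.sqrt nY * Real.sqrt nH + 32 / c₀ k * Real.sqrt nH * Real.sqrt nY +
            32 / c₀ k * Real.sqrt nH * Real.sqrt nH := add_le_add_three h1 h2 h3
      _ = 32 / c₀ k * (2 * Real.sqrt nY * Real.sqrt nH + Real.sqrt nH * Real.sqrt nH) := by ring
      _ = 32 / c₀ k * (2 * Real.sqrt nY * Real.sqrt nH + nH) := by rw [h4]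
      _ ≤ 32 * (t k + 1) * (2 * Real.sqrt nY * Real.sqrt nH + nH) :=
          mul_le_mul_of_nonneg_right h5 hmix0
  have hER : |∑ k : Fin 4 → Fin M, (bf k Y H + bf k H Y + bf k H H)| ≤
      32 * Λ * (2 * Real.sqrt nY * Real.sqrt nH + nH) :=
    (Finset.abs_sum_le_sum_abs _ _).trans (by
      rw [hΛ_def, Finset.mul_sum, Finset.sum_mul]
      exact Finset.sum_le_sum fun k _ => herr k)
  -- the real bookkeeping (the sibling's, `K_q = 0`)
  rw [hQ, ← zero_sub]
  exact bookkeeping rfl hL hDab hMgY hTb hER hb hb0 hK hnY hnH hη0 hη1 hD0 hDF hΛ hΛ0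
    (le_max_right _ _) hM4 hc'

end Summit.QuantumFields.QCD.Cruxes.FlatCellOptimal.OneLoop

end
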